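import Summits.HubbardSuperconductivity.HubbardSuperconductivity.Theorems.BirGappedPhaseReductionR.Negative.NoExactFiniteTable
import Literature.NumberTheory.EllipticCurves.JacobiThetaDerivativeFormula

/-!
# Crux `BirGappedPhaseReductionR` (item `stmt-HubbardSuperconductivity-14846`): hypothesis (A) of the engine forces ZERO-FREE weights in the unit strip

Negative-side lemma of the standing disprover of crux 4R of route BalabanIR
(`BirGappedPhaseReductionR := BirComplexStableXYR → BirBdGPhaseCoercivity → BirGroundStateAverageLRO`).
Hypothesis (A) of the restated engine 2R bounds the table in the exponentially weighted norm
`Σ_n ‖c_n‖ e^{|n|₁} ≤ B`, i.e. the local action `F` is analytic and bounded in the strip `|Im φ_w| < 1`.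
Consequence recorded here, for a one-parameter (e.g. one temporal bond) family, and for ARBITRARY — finitely
or infinitely supported, (A)-summable — tables:

* `weight_ne_zero_on_strip_of_summable` — if `Σ_n ‖c_n‖ e^{|n|} < ∞` and an analytic `k` on the strip
  `U = {|Im z| < 1}` agrees on `ℝ` with the weight `exp(Σ_n c_n e^{inα})`, then `k` has NO zero in `U`
  (the series is analytic on `U` by the Weierstrass M-test; identity theorem on the convex strip);
* `thetaKernel_not_admissible` — using the tree's `Literature…JacobiThetaNull.jacobiTheta₂_halfPeriod`
  (`Θ((1+τ)/2 | τ) = 0`): for `0 < a < 1` the periodised Gaussian (Villain) kernel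
  `Σ_m e^{-am²} e^{imα} = Θ(α/2π | ia/π)` vanishes at `α = π + ia`, inside the unit strip, hence is
  `exp(Σ_n c_n e^{inα})` on `ℝ` for NO (A)-summable table `c` — whatever the budget `B`.

READING FOR CRUX 4R (the route's own "cheapest falsifier" for 4R — one-page power counting of the induced
window action's (A)/(C) constants against `K ~ E_F/Δ` — comes out NEGATIVE for the dictionary as designed).
With ISOTROPIC blocks (side `ξ = v_F/Δ`, Trotter step `a = 1/Δ`, the route's choice making both stiffnesses
`~K`), the TEMPORAL factor of the block weight is the charge-transfer kernel `k(α) = Σ_m p_m e^{imα}` with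
`p_m` the distribution of the pair charge transferred through the block in time `a`, of variance
`σ² = C/a = χ ξ² Δ ~ K` (block capacitance `C = χξ²`): a periodised Gaussian (Villain kernel), with a complex
zero at `α = π + i/(2σ²)` (`thetaKernel_not_admissible`, `a = 1/(2σ²)`) — INSIDE the unit strip as soon as
`σ² > 1/2`.  So such a weight is `e^{-K F_c}` for NO (A)-admissible table `c`, whatever `B`: the exact temporal action is
Villain-type (cusp at `α = π` rounded on the scale `1/K`; Fourier coefficients `~ e^{-|n|/(2K)}/n²`), not cosine-type.  The anisotropic
repair (time step `a ~ C = χξ² ~ E_F/Δ²`, making `σ² = O(1)` and the temporal kernel entire-like) makes the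
spatial coupling `aE_J ~ K²` and hence the temporal COERCIVITY constant `c₀ ~ 1/K²` in units of the spatial
stiffness — which hypothesis (C) (all window pairs, one `c₀`) and the threshold `K₀(r, B, c₀)` do not tolerate
uniformly (`…EngineThresholdScaling`: `K₀` is not uniform in `c₀`).  So the induced action of the gapped Hubbard
window is outside the typed class 2R along `U ↓ 0` under either block geometry; consuming `h2R` needs 2R re-typed
((A) with a `K`-dependent strip / kernel-level hypotheses; temporal (C) decoupled from spatial), in addition to
the block-level restatement of crux 3.  The finite-table special case is `cexp_ne_affine_cos`
(`…NoExactFiniteTable`).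

Standing disprover refuter-cdisprove-stmt-HubbardSuperconductivity-14846-0, 2026-08-16; work file
`Cruxes/BirGappedPhaseReductionR/Disproof.lean`.  NO definition is introduced; nothing asserts a `Theses` decl.
References: Weierstrass M-test / identity theorem (Mathlib `Complex.differentiableOn_tsum_of_summable_norm`,
`AnalyticOnNhd.eqOn_zero_of_preconnected_of_frequently_eq_zero`); J. Villain, J. Phys. (Paris) 36 (1975) 581;
M. P. A. Fisher, G. Grinstein, Phys. Rev. Lett. 60 (1988) 208 (quantum rotor / Josephson-array description of a
superconductor at scales above `ξ`). [folklore]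
-/

noncomputable section

namespace Summit.HubbardSuperconductivity.HubbardSuperconductivity.Theorems.BirGappedPhaseReductionR.Negative

open Complex Filter Set
open scoped Topology Real

/-- the open unit strip `{|Im z| < 1}` is open. [folklore] -/
theorem isOpen_unitStrip : IsOpen {z : ℂ | |z.im| < 1} :=
  isOpen_lt (continuous_abs.comp Complex.continuous_im) continuous_const

/-- the open unit strip is convex, hence preconnected. [folklore] -/
theorem isPreconnected_unitStrip : IsPreconnected {z : ℂ | |z.im| < 1} := by
  refine Convex.isPreconnected ?_
  intro x hx y hy a b ha hb hab
  simp only [mem_setOf_eq, Complex.add_im, Complex.smul_im, smul_eq_mul] at hx hy ⊢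
  calc |a * x.im + b * y.im| ≤ |a * x.im| + |b * y.im| := abs_add_le _ _
    _ = a * |x.im| + b * |y.im| := by rw [abs_mul, abs_mul, abs_of_nonneg ha, abs_of_nonneg hb]
    _ < 1 := by
        rcases ha.eq_or_lt with rfl | ha'
        · simp only [zero_mul, zero_add] at hab ⊢; rw [hab, one_mul]; exact hy
        · nlinarith

/-- one Fourier mode is bounded on the unit strip by its (A)-weight: `‖c e^{inz}‖ ≤ ‖c‖ e^{|n|}`. [folklore] -/
theorem norm_mode_le_on_strip (c : ℂ) (n : ℤ) (z : ℂ) (hz : |z.im| < 1) :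
    ‖c * cexp (I * (n : ℂ) * z)‖ ≤ ‖c‖ * Real.exp |(n : ℝ)| := by
  rw [norm_mul, Complex.norm_exp]
  refine mul_le_mul_of_nonneg_left (Real.exp_le_exp.mpr ?_) (norm_nonneg _)
  have hre : (I * (n : ℂ) * z).re = -((n : ℝ) * z.im) := by
    simp [Complex.mul_re, Complex.mul_im]
  rw [hre]
  calc -((n : ℝ) * z.im) ≤ |(n : ℝ) * z.im| := neg_le_abs _
    _ = |(n : ℝ)| * |z.im| := abs_mul _ _
    _ ≤ |(n : ℝ)| * 1 := mul_le_mul_of_nonneg_left hz.le (abs_nonneg _)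
    _ = |(n : ℝ)| := mul_one _

/-- an (A)-summable Fourier series is analytic on the unit strip (Weierstrass M-test). [folklore] -/
theorem differentiableOn_fourierSeries_strip (c : ℤ → ℂ)
    (hA : Summable fun n : ℤ => ‖c n‖ * Real.exp |(n : ℝ)|) :
    DifferentiableOn ℂ (fun z : ℂ => ∑' n : ℤ, c n * cexp (I * (n : ℂ) * z)) {z : ℂ | |z.im| < 1} :=
  Complex.differentiableOn_tsum_of_summable_norm hA (fun n => by fun_prop) isOpen_unitStrip
    (fun n z hz => norm_mode_le_on_strip (c n) n z hz)

/-- **(A) forces zero-free weights in the unit strip.**  If `Σ_n ‖c_n‖ e^{|n|} < ∞` and an analytic function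
`k` on the strip `{|Im z| < 1}` coincides on `ℝ` with the weight `exp(Σ_n c_n e^{inα})`, then `k ≠ 0` on the
whole strip. [folklore] -/
theorem weight_ne_zero_on_strip_of_summable (c : ℤ → ℂ)
    (hA : Summable fun n : ℤ => ‖c n‖ * Real.exp |(n : ℝ)|)
    (k : ℂ → ℂ) (hk : DifferentiableOn ℂ k {z : ℂ | |z.im| < 1})
    (h : ∀ α : ℝ, k (α : ℂ) = cexp (∑' n : ℤ, c n * cexp (I * (n : ℂ) * (α : ℂ)))) :
    ∀ z : ℂ, |z.im| < 1 → k z ≠ 0 := by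
  set U : Set ℂ := {z : ℂ | |z.im| < 1} with hU
  set F : ℂ → ℂ := fun z => ∑' n : ℤ, c n * cexp (I * (n : ℂ) * z) with hF
  have hFd : DifferentiableOn ℂ F U := differentiableOn_fourierSeries_strip c hA
  set g : ℂ → ℂ := fun z => k z - cexp (F z) with hg
  have hgd : DifferentiableOn ℂ g U := hk.sub (hFd.cexp)
  have hga : AnalyticOnNhd ℂ g U := hgd.analyticOnNhd isOpen_unitStrip
  have hzero : ∀ x : ℝ, g (x : ℂ) = 0 := fun x => by
    simp only [hg, hF, h x, sub_self]
  have h0U : (0 : ℂ) ∈ U := by simp [hU]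
  have hfreq : ∃ᶠ z in 𝓝[≠] (0 : ℂ), g z = 0 := frequently_ofReal_nhdsWithin_zero hzero
  have hg0 : EqOn g 0 U :=
    hga.eqOn_zero_of_preconnected_of_frequently_eq_zero isPreconnected_unitStrip h0U hfreq
  intro z hz
  have : g z = 0 := hg0 (show z ∈ U from hz)
  rw [hg] at this
  have hkz : k z = cexp (F z) := sub_eq_zero.mp this
  rw [hkz]
  exact Complex.exp_ne_zero _


/-! ### The Gaussian (Villain) charge-transfer kernel is outside the (A)-class -/

/-- **The periodised Gaussian kernel is not an admissible weight.**  For `0 < a < 1` the kernel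
`k(α) = Σ_m e^{-a m²} e^{imα} = Θ(α/2π | ia/π)` — the charge-transfer (Villain) kernel of a block whose pair
charge has Gaussian fluctuations of variance `σ² = 1/(2a) > 1/2` per time step — is `exp(Σ_n c_n e^{inα})` on `ℝ`
for NO table `c` with `Σ_n ‖c_n‖ e^{|n|} < ∞`: it vanishes at `α = π + ia`, inside the unit strip.  In the
BalabanIR dictionary `σ² ~ K → ∞`, i.e. `a → 0`. [folklore] -/
theorem thetaKernel_not_admissible (a : ℝ) (ha : 0 < a) (ha1 : a < 1) (c : ℤ → ℂ)
    (hA : Summable fun n : ℤ => ‖c n‖ * Real.exp |(n : ℝ)|) :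
    ¬ ∀ α : ℝ, jacobiTheta₂ ((α : ℂ) / (2 * π)) (I * a / π) =
        cexp (∑' n : ℤ, c n * cexp (I * (n : ℂ) * (α : ℂ))) := by
  intro h
  have hτ : 0 < (I * (a : ℂ) / π).im := by
    have : (I * (a : ℂ) / π).im = a / π := by
      rw [show I * (a : ℂ) / π = ((a / π : ℝ) : ℂ) * I by push_cast; ring]
      simp [Complex.mul_im]
    rw [this]; positivity
  have hk : Differentiable ℂ (fun z : ℂ => jacobiTheta₂ (z / (2 * π)) (I * a / π)) := fun z => by
    have h1 : DifferentiableAt ℂ (jacobiTheta₂ · (I * a / π)) (z / (2 * π)) :=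
      differentiableAt_jacobiTheta₂_fst (z / (2 * π)) hτ
    have h2 : DifferentiableAt ℂ (fun z : ℂ => z / (2 * π)) z := differentiableAt_id.div_const _
    exact h1.comp z h2
  have hne := weight_ne_zero_on_strip_of_summable c hA _ hk.differentiableOn h ((π : ℂ) + I * a) (by
    simp only [Complex.add_im, Complex.ofReal_im, Complex.mul_im, Complex.I_re,
      Complex.I_im, Complex.ofReal_re, zero_mul, one_mul, zero_add]
    rwa [abs_of_pos ha])
  apply hne
  have e : ((π : ℂ) + I * a) / (2 * π) = (1 + I * a / π) / 2 := by
    field_simp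
  show jacobiTheta₂ (((π : ℂ) + I * a) / (2 * π)) (I * a / π) = 0
  rw [e]
  exact Literature.NumberTheory.EllipticCurves.JacobiThetaNull.jacobiTheta₂_halfPeriod _

end Summit.HubbardSuperconductivity.HubbardSuperconductivity.Theorems.BirGappedPhaseReductionR.Negative
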